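import Literature.IUT.HodgeArakelov.GlobalGaussianFrobenioidsCor4748Proofs
import Literature.IUT.HodgeTheaters.GlobalFrobenioidsGaloisChart
import HarnessLib

/-!
# [IUTchII] Cor 4.8 (i) «by restricting Kummer classes»: the Kummer hypothesis of
# `GlobalGaussianFrobenioidsCor4748Proofs.lean` is NON-VACUOUS — the tautological model and the Galois chart

S. Mochizuki, *Inter-universal Teichmüller theory II*, §4, kurims Dec-2020 manuscript, Corollary 4.8 (i) p. 150
l. 1–25 [cite: Mochizuki2012, Cor 4.8 (i) p.150]; the inputs quoted there are [IUTchI] Example 5.1 (i), (iv), (v)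
(kurims May-2020 pp. 123–130). Claim key DISPUTED (D-0012). PROOF-ONLY companion (abc-iut cell, layer L6, seat
abc-iut-w4-d035 gen 5; non-vacuity witness for cone row IUTchII:Cor4.8(i)); NO definition, NO `Prop` fact, NO
instance.

`GlobalGaussianFrobenioidsCor4748Proofs.lean` proves Cor 4.8 (i)'s «by restricting Kummer classes … natural
Kummer-theoretic isomorphisms `†𝕄^⊛_mod ⥲ 𝕄^⊛_mod(†𝒟^⊚)`, `†𝕄^⊛_sol ⥲ 𝕄^⊛_sol(†𝒟^⊚)`» for ANY
`π₁(†𝒟^⊛)`-equivariant multiplicative isomorphism `κ : 𝒪̃^⊛× ⥲ 𝕄^⊛(†𝒟^⊚)` from the Frobenioid-side pair of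
[IUTchI] Ex 5.1 (iv) (abc-iut-L5-t1's `BirationalData.Otilde`) to the étale-side reconstruction output of Ex 5.1 (i)
(`NFBridgeRecon.Mast = 𝕄̄^⊛(†𝒟^⊚)^×`). This file shows the hypothesis is INHABITED at the intended object:

* `exists_birationalData_equivariant_kummer` — for EVERY reconstruction output `N`, the Frobenioid-side pair whose
  `𝒪̃^⊛×` IS the unit group `𝕄̄^⊛(†𝒟^⊚)^×` with the `π₁(†𝒟^⊛)`-action induced from the field action (Mathlib's
  `Units.mulDistribMulActionRight`; open stabilisers inherited from `N.isOpen_stabilizer_fbar`) carries the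
  identity as an equivariant Kummer isomorphism, and the restricted bijection of invariants of
  `kummer_map_fixedPoints_eq_mmod` lands on `𝕄^⊛_mod(†𝒟^⊚)` (the remaining `BirationalData` fields — primes,
  integral submonoids, decomposition groups — are filled trivially and play no role in Cor 4.8 (i); this is the
  tautological model of Ex 5.1 (iv)–(v) "`π₁(†𝒟^⊛) ↷ †𝕄^⊛ := the pair `π₁(†𝒟^⊛) ↷ 𝒪̃^⊛×` of (iv)"", honest label);
* `kummer_map_fixedPoints_iff_of_chart` — through a Galois chart `𝕄̄^⊛(†𝒟^⊚) ≅ F̄` (abc-iut-w4-d050's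
  `NFBridgeRecon.GaloisChart`, [IUTchI] Ex 5.1 (i) "an isomorph of `F̄` … corresponding to `F_mod ⊆ F̄`") the target
  of ANY restricted Kummer isomorphism is exactly `F^×_mod ⊆ F̄^×` (the bottom field's non-zero elements), i.e. the
  printed "`†𝕄^⊛_mod ⥲ 𝕄^⊛_mod(†𝒟^⊚)` [≅ `F^×_mod`]".

Nothing here asserts a disputed claim or takes a side on [IUTchIII] Cor 3.12; typed ≠ proved ≠ endorsed.
-/

namespace Literature.IUT.HodgeArakelov

open Literature.IUT.HodgeTheaters

/-- **[IUTchII] Cor 4.8 (i)** (p. 150) / **[IUTchI] Ex 5.1 (iv)–(v)** (pp. 126–127, "`π₁(†𝒟^⊛) ↷ †𝕄^⊛`, i.e. the pair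
`π₁(†𝒟^⊛) ↷ 𝒪̃^⊛×` of (iv)"): NON-VACUITY of the equivariant-Kummer hypothesis of
`kummer_map_fixedPoints_eq_mmod` at EVERY reconstruction output `N` — the tautological Frobenioid-side pair
`𝒪̃^⊛× := 𝕄̄^⊛(†𝒟^⊚)^×` (action induced from the field action, open stabilisers) with `κ = id` is equivariant,
and the restricted bijection of `π₁(†𝒟^⊛)`-invariants lands EXACTLY on `𝕄^⊛_mod(†𝒟^⊚)`.
[cite: Mochizuki2012, Cor 4.8 (i) p.150] -/
theorem exists_birationalData_equivariant_kummer (N : NFBridgeRecon.{0}) :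
    ∃ (β : BirationalData N.piDast) (κ : β.Otilde ≃* N.Mast),
      (∀ (g : N.piDast) (x : β.Otilde), ((κ (g • x) : N.Mast) : N.Fbar) = g • ((κ x : N.Mast) : N.Fbar)) ∧
        (FixedPoints.subgroup N.piDast β.Otilde).map κ.toMonoidHom = N.Mmod := by
  letI : MulDistribMulAction N.piDast N.Mast := Units.mulDistribMulActionRight
  have hstab : ∀ x : N.Mast, IsOpen (MulAction.stabilizer N.piDast x : Set N.piDast) := by
    intro x
    have hx := N.isOpen_stabilizer_fbar (x : N.Fbar)
    have heq : (MulAction.stabilizer N.piDast x : Set N.piDast) =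
        (MulAction.stabilizer N.piDast (x : N.Fbar) : Set N.piDast) := by
      ext g
      simp only [SetLike.mem_coe, MulAction.mem_stabilizer_iff]
      constructor
      · intro h
        rw [← Units.coe_smul, h]
      · intro h
        exact Units.ext (by rw [Units.coe_smul, h])
    rw [heq]
    exact hx
  let β : BirationalData N.piDast :=
    { Otilde := N.Mast
      otildeAction := Units.mulDistribMulActionRight
      isOpen_stabilizer := hstab
      PrimeIdx := PUnit
      Oint := fun _ => ⊤
      PrimeIdx0 := PUnit
      over := fun p => p
      decomp := fun _ => ⊤
      IsNonarch := fun _ => True }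
  have hκ : ∀ (g : N.piDast) (x : β.Otilde),
      (((MulEquiv.refl β.Otilde) (g • x) : N.Mast) : N.Fbar) = g • (((MulEquiv.refl β.Otilde) x : N.Mast) : N.Fbar) :=
    fun g x => rfl
  exact ⟨β, MulEquiv.refl _, hκ, kummer_map_fixedPoints_eq_mmod N β (MulEquiv.refl _) hκ⟩

/-- **[IUTchII] Cor 4.8 (i)** (p. 150, "`†𝕄^⊛_mod ⥲ 𝕄^⊛_mod(†𝒟^⊚)`") read through a Galois chart `𝕄̄^⊛(†𝒟^⊚) ≅ F̄`
([IUTchI] Ex 5.1 (i) "corresponding to `F^×_mod ⊆ F̄^×`", abc-iut-w4-d050's `GaloisChart.mem_mmod_iff`): for ANY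
`π₁(†𝒟^⊛)`-equivariant Kummer isomorphism `κ`, an element lies in the image of the Frobenioid-side invariants
`†𝕄^⊛_mod` iff its chart image is a (non-zero) element of the bottom field `F_mod`. [cite: Mochizuki2012, Cor 4.8 (i) p.150] -/
theorem kummer_map_fixedPoints_iff_of_chart (N : NFBridgeRecon.{0}) {F : Type} [Field F] [NumberField F]
    (c : N.GaloisChart F) (β : BirationalData N.piDast) (κ : β.Otilde ≃* N.Mast)
    (hκ : ∀ (g : N.piDast) (x : β.Otilde), ((κ (g • x) : N.Mast) : N.Fbar) = g • ((κ x : N.Mast) : N.Fbar))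
    (y : N.Mast) :
    y ∈ (FixedPoints.subgroup N.piDast β.Otilde).map κ.toMonoidHom ↔
      c.iso (y : N.Fbar) ∈ (⊥ : IntermediateField F (Literature.AlgebraicGeometry.Frobenioids.QuasiTemperoid.Fbar F)) := by
  rw [kummer_map_fixedPoints_eq_mmod N β κ hκ]
  exact c.mem_mmod_iff y

end Literature.IUT.HodgeArakelov
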